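import Summits.QuantumFields.YangMills.Theorems.IR.Negative.TypShellCondFalseAllG.Comb
import Literature.Barriers.QuantumFields.FiniteTemperatureReflection
import Literature.Barriers.QuantumFields.FiniteTemperatureOneLayer

/-!
# Crux `IR` (stmt-QuantumFields-19354) — the fixed-mesh negative for format T and the onset floor FOR EVERY COMPACT
# GAUGE GROUP, part 4/8: §8 local planar Stokes and the zero-temperature value of the twisted world (section `ZeroTemp`)

Re-homed VERBATIM (statements, proofs, names; namespace `…Cruxes.IR.CruxIdea2g6` ↦ `…Cruxes.IR.FixedMeshAllG`) from the crux
workfile `Cruxes/IR/CruxIdea2FrameRowAllG.lean` rev 2 (sha16 81bea4c546c46a61; author `ym-cruxidea-19354-2` GEN 6) per owner R88,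
split by its sections into eight ≤ 400-line modules chained by import; credit docstring of record in the headline module
`Theorems/IR/Negative/TypShellCondFalseAllG.lean` (part 8/8).  Negative knowledge for stmt-QuantumFields-19354; closes no stub.
-/

set_option autoImplicit false

noncomputable section

open MeasureTheory Filter Topology
open Literature.MathematicalPhysics.QuantumLattice
open Literature.Probability.LatticeModels
open Summit.QuantumFields.YangMills.Cruxes.IR.Tempered (cellEdges windowCells regionEdges)
open Summit.QuantumFields.YangMills.Cruxes.IR.ShellTempered (windowCellsPlus)
open Summit.QuantumFields.YangMills.Cruxes.IR.OnsetFormats (TypShellCond shellCount)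
open Summit.QuantumFields.YangMills.Cruxes.IR.FixedMesh

namespace Summit.QuantumFields.YangMills.Cruxes.IR.FixedMeshAllG

/-! ## §8 Local planar Stokes and the zero-temperature value of the twisted world (PROVED) -/

section ZeroTemp

open Literature.MathematicalPhysics.QuantumFieldTheory (GaugeConfig wilsonAction plaquetteHolonomy)
open Summit.QuantumFields.YangMills.Theorems.TunedSequenceExists.Negative.Freezing (re_trace_le_of_mem_unitaryGroup
  re_trace_eq_of_wilsonAction_eq_zero plaquetteHolonomyZd_torusLift')

variable {G : Type} [Group G] [TopologicalSpace G] [IsTopologicalGroup G] [CompactSpace G]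
  [SecondCountableTopology G] [MeasurableSpace G] [BorelSpace G]
  {N : ℕ} (ρ : G →* Matrix (Fin N) (Fin N) ℂ)

omit [TopologicalSpace G] [IsTopologicalGroup G] [CompactSpace G] [SecondCountableTopology G]
  [MeasurableSpace G] [BorelSpace G] in
/-- One flat plaquette determines its top link. -/
theorem link_of_flatAt {U : LGConfig 4 G} {t s : ℤ} (h : plaquetteHolonomyZd U (site2 t s) 0 1 = 1) :
    U (site2 (t + 1) s, 1) = (U (site2 t s, 0))⁻¹ * U (site2 t s, 1) * U (site2 t (s + 1), 0) := by
  rw [plaquetteHolonomyZd, site2_add_single_zero, site2_add_single_one] at h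
  calc U (site2 (t + 1) s, 1)
      = (U (site2 t s, 0))⁻¹ * (U (site2 t s, 0) * U (site2 (t + 1) s, 1) * (U (site2 t (s + 1), 0))⁻¹ *
          (U (site2 t s, 1))⁻¹) * U (site2 t s, 1) * U (site2 t (s + 1), 0) := by group
    _ = _ := by rw [h]; group

omit [TopologicalSpace G] [IsTopologicalGroup G] [CompactSpace G] [SecondCountableTopology G]
  [MeasurableSpace G] [BorelSpace G] in
/-- LOCAL strip Stokes: flatness only on the strip `[0,A₀) × {M}`. -/
theorem strip_eq_one_local {U : LGConfig 4 G} (M : ℕ) {A₀ : ℕ}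
    (hU : ∀ t : ℕ, t < A₀ → plaquetteHolonomyZd U (site2 t M) 0 1 = 1) : ∀ A : ℕ, A ≤ A₀ →
    upT U M A * U (site2 (A : ℤ) M, 1) * (upT U ((M : ℤ) + 1) A)⁻¹ * (U (site2 0 (M : ℤ), 1))⁻¹ = 1 := by
  intro A
  induction A with
  | zero => intro; simp
  | succ A ih =>
    intro hA
    rw [upT_succ, upT_succ]
    push_cast
    have h1 := link_of_flatAt (hU A (by omega))
    have h2 : upT U (M : ℤ) A =
        U (site2 0 (M : ℤ), 1) * upT U ((M : ℤ) + 1) A * (U (site2 (A : ℤ) (M : ℤ), 1))⁻¹ := by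
      calc upT U (M : ℤ) A
          = (upT U M A * U (site2 (A : ℤ) M, 1) * (upT U ((M : ℤ) + 1) A)⁻¹ * (U (site2 0 (M : ℤ), 1))⁻¹) *
              (U (site2 0 (M : ℤ), 1) * upT U ((M : ℤ) + 1) A * (U (site2 (A : ℤ) (M : ℤ), 1))⁻¹) := by group
        _ = _ := by rw [ih (by omega)]; group
    rw [h1, h2]
    group

omit [TopologicalSpace G] [IsTopologicalGroup G] [CompactSpace G] [SecondCountableTopology G]
  [MeasurableSpace G] [BorelSpace G] in
/-- LOCAL rectangle Stokes: flatness only on `[0,A) × [0,M₀)`. -/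
theorem rect_eq_one_local {U : LGConfig 4 G} (A : ℕ) {M₀ : ℕ}
    (hU : ∀ t s : ℕ, t < A → s < M₀ → plaquetteHolonomyZd U (site2 t s) 0 1 = 1) : ∀ M : ℕ, M ≤ M₀ →
    upT U 0 A * rightT U (A : ℤ) M * (upT U (M : ℤ) A)⁻¹ * (rightT U 0 M)⁻¹ = 1 := by
  intro M
  induction M with
  | zero => intro; simp
  | succ M ih =>
    intro hM
    rw [rightT_succ, rightT_succ]
    push_cast
    have hs := strip_eq_one_local M (fun t ht => hU t M ht (by omega)) A le_rfl
    have h1 : (upT U ((M : ℤ) + 1) A)⁻¹ =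
        (U (site2 (A : ℤ) (M : ℤ), 1))⁻¹ * (upT U (M : ℤ) A)⁻¹ * U (site2 0 (M : ℤ), 1) := by
      calc (upT U ((M : ℤ) + 1) A)⁻¹
          = (U (site2 (A : ℤ) (M : ℤ), 1))⁻¹ * (upT U (M : ℤ) A)⁻¹ *
              (upT U M A * U (site2 (A : ℤ) M, 1) * (upT U ((M : ℤ) + 1) A)⁻¹ * (U (site2 0 (M : ℤ), 1))⁻¹) *
              U (site2 0 (M : ℤ), 1) := by group
        _ = _ := by rw [hs]; group
    have h2 : upT U 0 A = rightT U 0 M * upT U (M : ℤ) A * (rightT U (A : ℤ) M)⁻¹ := by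
      calc upT U 0 A = (upT U 0 A * rightT U (A : ℤ) M * (upT U (M : ℤ) A)⁻¹ * (rightT U 0 M)⁻¹) *
            (rightT U 0 M * upT U (M : ℤ) A * (rightT U (A : ℤ) M)⁻¹) := by group
        _ = _ := by rw [ih (by omega)]; group
    rw [h1, h2]
    group

omit [TopologicalSpace G] [IsTopologicalGroup G] [CompactSpace G] [SecondCountableTopology G]
  [MeasurableSpace G] [BorelSpace G] in
/-- **LOCAL Stokes for the rectangle loop (PROVED)**: flatness on the `(b+1) × m` plaquettes of the rectangle suffices. -/
theorem col_mul_staple_eq_one_local {U : LGConfig 4 G} {b : ℕ} (hb : 1 ≤ b) (m : ℕ)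
    (hU : ∀ t s : ℕ, t < b + 1 → s < m → plaquetteHolonomyZd U (site2 t s) 0 1 = 1) :
    col b U * staple b m U = 1 := by
  have hrect := rect_eq_one_local (b + 1) hU m le_rfl
  push_cast at hrect
  rw [← mul_col_eq_upT hb U] at hrect
  rw [staple_eq_transport]
  have hcol : col b U = (U (site2 0 0, 0))⁻¹ *
      (rightT U 0 m * upT U (m : ℤ) (b + 1) * (rightT U ((b : ℤ) + 1) m)⁻¹) := by
    calc col b U = (U (site2 0 0, 0))⁻¹ * (U (site2 0 0, 0) * col b U * rightT U ((b : ℤ) + 1) m *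
          (upT U (m : ℤ) (b + 1))⁻¹ * (rightT U 0 m)⁻¹) *
          (rightT U 0 m * upT U (m : ℤ) (b + 1) * (rightT U ((b : ℤ) + 1) m)⁻¹) := by group
      _ = _ := by rw [hrect]; group
  rw [hcol]
  group

omit [TopologicalSpace G] [IsTopologicalGroup G] [CompactSpace G] [SecondCountableTopology G]
  [MeasurableSpace G] [BorelSpace G] in
/-- Zero torus action ⇒ torus-flat (all planes, faithful unitary `ρ`). -/
theorem torusFlat_of_wilsonAction_eq_zero {L : ℕ} [NeZero L] (hρu : ∀ g, ρ g ∈ Matrix.unitaryGroup (Fin N) ℂ)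
    (hρi : Function.Injective ρ) {V : GaugeConfig 4 L G} (h0 : wilsonAction ρ V = 0) :
    ∀ x (i j : Fin 4), plaquetteHolonomy V x i j = 1 := by
  have base : ∀ x (i j : Fin 4), i < j → plaquetteHolonomy V x i j = 1 := fun x i j hij => by
    have htr := re_trace_eq_of_wilsonAction_eq_zero ρ (fun g => re_trace_le_of_mem_unitaryGroup (hρu g)) h0 x i j hij
    exact hρi (by rw [Literature.Barriers.QuantumFields.eq_one_of_re_trace_eq (hρu _) htr, map_one])
  intro x i j
  rcases lt_trichotomy i j with hij | rfl | hji
  · exact base x i j hij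
  · simp [plaquetteHolonomy]
  · have h := base x j i hji
    unfold plaquetteHolonomy at h ⊢
    calc V (x, i) * V (x.shift i, j) * (V (x.shift j, i))⁻¹ * (V (x, j))⁻¹
        = (V (x, j) * V (x.shift j, i) * (V (x.shift i, j))⁻¹ * (V (x, i))⁻¹)⁻¹ := by group
      _ = 1 := by rw [h, inv_one]

omit [TopologicalSpace G] [IsTopologicalGroup G] [CompactSpace G] [SecondCountableTopology G]
  [MeasurableSpace G] [BorelSpace G] in
/-- Workfile theorem `flatZd_torusLift` (cruxidea-2 g6, `CruxIdea2FrameRowAllG.lean` rev 2, re-homed verbatim;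
see the module docstring). -/
theorem flatZd_torusLift {L : ℕ} {V : GaugeConfig 4 L G} (hV : ∀ x (i j : Fin 4), plaquetteHolonomy V x i j = 1) :
    FlatZd (torusLift L V) := fun y i j => by
  rw [plaquetteHolonomyZd_torusLift']; exact hV _ _ _

omit [TopologicalSpace G] [IsTopologicalGroup G] [CompactSpace G] [SecondCountableTopology G]
  [MeasurableSpace G] [BorelSpace G] in
/-- Base points of plaquettes touching the row region have spatial coordinates `≥ -S`. -/
theorem base_ge_of_mem_plaquettesTouching {b n : ℕ} {p : ZdPlaquette 4} (hp : p ∈ plaquettesTouching (rowRegion b n)) :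
    ∀ l : Fin 4, l ≠ 0 → -(((2 * n + 2) * b + 1 : ℕ) : ℤ) ≤ p.1 l := by
  intro l _
  have he : (p.1, p.2.1.1) ∈ rowRegion b n ∪ (plaquettesTouching (rowRegion b n)).biUnion plaquetteEdges :=
    Finset.mem_union_right _ (Finset.mem_biUnion.2 ⟨p, hp, by simp [plaquetteEdges]⟩)
  have hbox := rowRegion_collar_mem_box b n _ he
  rw [mem_box] at hbox
  exact (hbox l).1

-- `trace_rep_conj` ∕ `re_trace_rep_inv` of the workfile ≡ the landed
-- `Literature.Barriers.QuantumFields.OneLayer.trace_rep_conj` ∕ `…FiniteTemperature.trace_re_rep_inv`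
-- (gate dedup rule: reused by name below instead of re-declared).

omit [TopologicalSpace G] [IsTopologicalGroup G] [CompactSpace G] [SecondCountableTopology G]
  [MeasurableSpace G] [BorelSpace G] in
/-- (c) The twisted datum has zero boundary energy on the row region. -/
theorem wilsonBoundaryAction_topTwist_eq_zero {ζ : LGConfig 4 G} (hζ : FlatZd ζ) {b n : ℕ} {k : Site 4 → G}
    (hk : LayerCov b ((2 * n + 2) * b + 1) ζ k) :
    wilsonBoundaryAction ρ (rowRegion b n) (topTwist b k ζ) = 0 := by
  refine Finset.sum_eq_zero fun p hp => ?_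
  have hflat : plaquetteHolonomyZd (topTwist b k ζ) p.1 p.2.1.1 p.2.1.2 = 1 :=
    flat_topTwist hζ hk (base_ge_of_mem_plaquettesTouching hp) p.2.2
  rw [plaquetteObs, hflat, map_one, Matrix.trace_one, Fintype.card_fin]
  simp

omit [Group G] [TopologicalSpace G] [IsTopologicalGroup G] [CompactSpace G] [SecondCountableTopology G]
  [MeasurableSpace G] [BorelSpace G] in
/-- Workfile theorem `glueWith_self` (cruxidea-2 g6, `CruxIdea2FrameRowAllG.lean` rev 2, re-homed verbatim;
see the module docstring). -/
theorem glueWith_self (Λ : Finset (ZdEdge 4)) (η : LGConfig 4 G) : glueWith Λ (fun e : ↥Λ => η e.1) η = η := by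
  funext e
  by_cases he : e ∈ Λ
  · rw [glueWith_apply_mem _ _ _ he]
  · rw [glueWith_apply_not_mem _ _ _ he]

omit [TopologicalSpace G] [IsTopologicalGroup G] [CompactSpace G] [SecondCountableTopology G]
  [MeasurableSpace G] [BorelSpace G] in
/-- (d) Zero boundary energy ⇒ every collar plaquette is trivial (faithful unitary `ρ`). -/
theorem touching_eq_one_of_wilsonBoundaryAction_eq_zero (hρu : ∀ g, ρ g ∈ Matrix.unitaryGroup (Fin N) ℂ)
    (hρi : Function.Injective ρ) {Λ : Finset (ZdEdge 4)} {W : LGConfig 4 G} (hW : wilsonBoundaryAction ρ Λ W = 0) :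
    ∀ p ∈ plaquettesTouching Λ, plaquetteHolonomyZd W p.1 p.2.1.1 p.2.1.2 = 1 := by
  intro p hp
  have hterm0 : ∀ q ∈ plaquettesTouching Λ, 0 ≤ (N : ℝ) - plaquetteObs ρ q.1 q.2.1.1 q.2.1.2 W := fun q _ =>
    sub_nonneg.2 (re_trace_le_of_mem_unitaryGroup (hρu _))
  have h := (Finset.sum_eq_zero_iff_of_nonneg hterm0).1 hW p hp
  have htr : (ρ (plaquetteHolonomyZd W p.1 p.2.1.1 p.2.1.2)).trace.re = N := by
    simp only [plaquetteObs] at h; linarith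
  exact hρi (by rw [Literature.Barriers.QuantumFields.eq_one_of_re_trace_eq (hρu _) htr, map_one])

omit [TopologicalSpace G] [IsTopologicalGroup G] [CompactSpace G] [SecondCountableTopology G]
  [MeasurableSpace G] [BorelSpace G] in
/-- Workfile theorem `wilsonBoundaryAction_nonneg'` (cruxidea-2 g6, `CruxIdea2FrameRowAllG.lean` rev 2, re-homed verbatim;
see the module docstring). -/
theorem wilsonBoundaryAction_nonneg' (hρu : ∀ g, ρ g ∈ Matrix.unitaryGroup (Fin N) ℂ) (Λ : Finset (ZdEdge 4))
    (W : LGConfig 4 G) : 0 ≤ wilsonBoundaryAction ρ Λ W :=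
  Finset.sum_nonneg fun _ _ => sub_nonneg.2 (re_trace_le_of_mem_unitaryGroup (hρu _))

omit [TopologicalSpace G] [IsTopologicalGroup G] [CompactSpace G] [SecondCountableTopology G]
  [MeasurableSpace G] [BorelSpace G] in
/-- The four edges of the `(0,1)` plaquette at `site2 t s`, as members of `plaquetteEdges`. -/
theorem mem_plaquetteEdges_01 (t s : ℤ) :
    (site2 t s, (0 : Fin 4)) ∈ plaquetteEdges ((site2 t s, ⟨((0 : Fin 4), (1 : Fin 4)), by decide⟩) : ZdPlaquette 4) ∧
    (site2 t s + Pi.single 0 1, (1 : Fin 4)) ∈ plaquetteEdges ((site2 t s, ⟨((0 : Fin 4), (1 : Fin 4)), by decide⟩) : ZdPlaquette 4) ∧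
    (site2 t s + Pi.single 1 1, (0 : Fin 4)) ∈ plaquetteEdges ((site2 t s, ⟨((0 : Fin 4), (1 : Fin 4)), by decide⟩) : ZdPlaquette 4) ∧
    (site2 t s, (1 : Fin 4)) ∈ plaquetteEdges ((site2 t s, ⟨((0 : Fin 4), (1 : Fin 4)), by decide⟩) : ZdPlaquette 4) := by
  simp [plaquetteEdges]

omit [TopologicalSpace G] [IsTopologicalGroup G] [CompactSpace G] [SecondCountableTopology G]
  [MeasurableSpace G] [BorelSpace G] in
/-- (e) The rectangle plaquettes of a glued configuration with trivial collar are trivial. -/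
theorem rect_flat_of_glue {ζ : LGConfig 4 G} (hζ : FlatZd ζ) {b n : ℕ} {k : Site 4 → G}
    (hk : LayerCov b ((2 * n + 2) * b + 1) ζ k) {W : LGConfig 4 G}
    (hWoff : ∀ e, e ∉ rowRegion b n → W e = topTwist b k ζ e)
    (hWp : ∀ p ∈ plaquettesTouching (rowRegion b n), plaquetteHolonomyZd W p.1 p.2.1.1 p.2.1.2 = 1)
    (t s : ℕ) : plaquetteHolonomyZd W (site2 t s) 0 1 = 1 := by
  by_cases hp : ((site2 t s, ⟨((0 : Fin 4), (1 : Fin 4)), by decide⟩) : ZdPlaquette 4) ∈ plaquettesTouching (rowRegion b n)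
  · exact hWp _ hp
  · have hout : ∀ e ∈ plaquetteEdges ((site2 t s, ⟨((0 : Fin 4), (1 : Fin 4)), by decide⟩) : ZdPlaquette 4),
        e ∉ rowRegion b n := fun e he heΛ =>
      hp (mem_plaquettesTouching_iff.2 ⟨e, Finset.mem_inter.2 ⟨he, heΛ⟩⟩)
    have hy : ∀ l : Fin 4, l ≠ 0 → -(((2 * n + 2) * b + 1 : ℕ) : ℤ) ≤ site2 t s l := fun l hl => by
      have h1 : site2 (t : ℤ) s l = if l = 1 then (s : ℤ) else 0 := by simp [site2, hl]
      rw [h1]; split_ifs <;> omega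
    have hflat : plaquetteHolonomyZd (topTwist b k ζ) (site2 t s) 0 1 = 1 := flat_topTwist hζ hk hy (by decide)
    have h4 := mem_plaquetteEdges_01 (t : ℤ) s
    unfold plaquetteHolonomyZd at hflat ⊢
    rw [hWoff _ (hout _ h4.1), hWoff _ (hout _ h4.2.1), hWoff _ (hout _ h4.2.2.1), hWoff _ (hout _ h4.2.2.2)]
    exact hflat

omit [TopologicalSpace G] [IsTopologicalGroup G] [CompactSpace G] [SecondCountableTopology G]
  [MeasurableSpace G] [BorelSpace G] in
/-- **THE ZERO-TEMPERATURE VALUE (PROVED).**  Torus `V` flat (`S_W(V) = 0`), `ζ = lift V`, `k` covariantly constant on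
the layer region (e.g. the comb), `η' = topTwist b k ζ`; if `x` MINIMISES the boundary action of the row region glued
into `η'`, then the σ-adapted charged test of the glued configuration equals `Re tr ρ(k(corner))/N` EXACTLY:
the twisted world has a zero-energy state (the twisted datum itself), so every minimiser is flat on the collar, the
rectangle loop of the minimiser is `1` by LOCAL Stokes, its staple is the twisted staple `A·k_c·A⁻¹·staple ζ`, and the
column read against the UNtwisted staple is a conjugate of `k_c⁻¹`. -/
theorem chargedTest_re_eq_of_minimiser {ζ : LGConfig 4 G} (hζ : FlatZd ζ)
    (hρu : ∀ g, ρ g ∈ Matrix.unitaryGroup (Fin N) ℂ) (hρi : Function.Injective ρ) {b : ℕ} (hb : 1 ≤ b) (n : ℕ)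
    {k : Site 4 → G} (hk : LayerCov b ((2 * n + 2) * b + 1) ζ k) {x : ↥(rowRegion b n) → G}
    (hmin : ∀ x' : ↥(rowRegion b n) → G,
      wilsonBoundaryAction ρ (rowRegion b n) (glueWith (rowRegion b n) x (topTwist b k ζ)) ≤
        wilsonBoundaryAction ρ (rowRegion b n) (glueWith (rowRegion b n) x' (topTwist b k ζ))) :
    (chargedTest ρ b ((2 * n + 1) * b) ζ (glueWith (rowRegion b n) x (topTwist b k ζ))).re =
      (ρ (k (site2 ((b : ℤ) + 1) (((2 * n + 1) * b : ℕ) : ℤ)))).trace.re / N := by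
  have hm : (((2 * n + 1) * b : ℕ) : ℤ) = (2 * (n : ℤ) + 1) * b := by push_cast; ring
  -- (c)+(d): the minimiser has zero boundary energy, all collar plaquettes trivial
  have hS0 := wilsonBoundaryAction_topTwist_eq_zero ρ hζ (n := n) hk
  have hSW : wilsonBoundaryAction ρ (rowRegion b n) (glueWith (rowRegion b n) x (topTwist b k ζ)) = 0 := by
    refine le_antisymm ?_ (wilsonBoundaryAction_nonneg' ρ hρu _ _)
    have h := hmin (fun e => topTwist b k ζ e.1)
    rwa [glueWith_self, hS0] at h
  have hWp := touching_eq_one_of_wilsonBoundaryAction_eq_zero ρ hρu hρi hSW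
  have hWoff : ∀ e, e ∉ rowRegion b n → glueWith (rowRegion b n) x (topTwist b k ζ) e = topTwist b k ζ e :=
    fun e he => glueWith_apply_not_mem _ _ _ he
  -- (e)+(f): local Stokes
  have hloop : col b (glueWith (rowRegion b n) x (topTwist b k ζ)) *
      staple b ((2 * n + 1) * b) (glueWith (rowRegion b n) x (topTwist b k ζ)) = 1 :=
    col_mul_staple_eq_one_local hb _ fun t s _ _ => rect_flat_of_glue hζ hk hWoff hWp t s
  have hst : staple b ((2 * n + 1) * b) (glueWith (rowRegion b n) x (topTwist b k ζ)) =
      topRun b ((2 * n + 1) * b) ζ * k (site2 ((b : ℤ) + 1) (((2 * n + 1) * b : ℕ) : ℤ)) *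
        (topRun b ((2 * n + 1) * b) ζ)⁻¹ * staple b ((2 * n + 1) * b) ζ := by
    rw [staple_eq_of_eq_off_row hm hWoff, staple_topTwist hb _ k ζ]
  -- (g): the value
  set A := topRun b ((2 * n + 1) * b) ζ
  set kc := k (site2 ((b : ℤ) + 1) (((2 * n + 1) * b : ℕ) : ℤ))
  set Sζ := staple b ((2 * n + 1) * b) ζ
  have hcol : col b (glueWith (rowRegion b n) x (topTwist b k ζ)) * Sζ = (Sζ⁻¹ * A) * kc⁻¹ * (Sζ⁻¹ * A)⁻¹ := by
    have : col b (glueWith (rowRegion b n) x (topTwist b k ζ)) = (A * kc * A⁻¹ * Sζ)⁻¹ := by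
      rw [← hst]; exact eq_inv_of_mul_eq_one_left hloop
    rw [this]; group
  rw [chargedTest, hcol, Literature.Barriers.QuantumFields.OneLayer.trace_rep_conj,
    Complex.div_natCast_re, Literature.Barriers.QuantumFields.FiniteTemperature.trace_re_rep_inv ρ hρu]

omit [TopologicalSpace G] [IsTopologicalGroup G] [CompactSpace G] [SecondCountableTopology G]
  [MeasurableSpace G] [BorelSpace G] in
/-- The comb instance: for a FLAT torus datum the value is `Re χ_ρ(k₀)/N`, whatever the datum. -/
theorem chargedTest_re_eq_of_minimiser_comb {L : ℕ} (hρu : ∀ g, ρ g ∈ Matrix.unitaryGroup (Fin N) ℂ)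
    (hρi : Function.Injective ρ) {b : ℕ} (hb : 1 ≤ b) (n : ℕ) (k₀ : G) {V : GaugeConfig 4 L G}
    (hV : ∀ x (i j : Fin 4), plaquetteHolonomy V x i j = 1) {x : ↥(rowRegion b n) → G}
    (hmin : ∀ x' : ↥(rowRegion b n) → G,
      wilsonBoundaryAction ρ (rowRegion b n) (glueWith (rowRegion b n) x
          (topTwist b (comb b ((2 * n + 2) * b + 1) k₀ (torusLift L V)) (torusLift L V))) ≤
        wilsonBoundaryAction ρ (rowRegion b n) (glueWith (rowRegion b n) x'
          (topTwist b (comb b ((2 * n + 2) * b + 1) k₀ (torusLift L V)) (torusLift L V)))) :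
    (chargedTest ρ b ((2 * n + 1) * b) (torusLift L V)
        (glueWith (rowRegion b n) x (topTwist b (comb b ((2 * n + 2) * b + 1) k₀ (torusLift L V)) (torusLift L V)))).re =
      (ρ k₀).trace.re / N := by
  have hζ : FlatZd (torusLift L V) := flatZd_torusLift hV
  rw [chargedTest_re_eq_of_minimiser ρ hζ hρu hρi hb n (layerCov_comb hζ _ _ k₀) hmin, comb]
  set P := stair b ((2 * n + 2) * b + 1) (torusLift L V) (site2 ((b : ℤ) + 1) (((2 * n + 1) * b : ℕ) : ℤ))
  have : P⁻¹ * k₀ * P = P⁻¹ * k₀ * P⁻¹⁻¹ := by rw [inv_inv]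
  rw [this, Literature.Barriers.QuantumFields.OneLayer.trace_rep_conj]

end ZeroTemp

end Summit.QuantumFields.YangMills.Cruxes.IR.FixedMeshAllG

end
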